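import Summits.CriticalPhenomena.PercolationContinuityZ3.Theorems.PercNearOneGluingNoHeavyLowerTailSahiTangentPatternTwoGrid
import Summits.CriticalPhenomena.PercolationContinuityZ3.Theorems.PercNearOneGluingNoHeavyLowerTailSahiGridCouplingFst

/-!
# `NoHeavyLowerTail` (crux stmt-CriticalPhenomena-4575), Sahi programme: **CONJECTURE T₃ FOR EVERY FKG WEIGHT ON `Bool × (grid of
# dimension ≤ 2)`** — `ν(top) · E₃^{ν(·|top)}(χ_{U¹}) ≤ E₃^{ν}(F_U)`

Support file (Sahi cell, seat `prim-sahi-p1`, generation 48; `--supports stmt-CriticalPhenomena-4575`).  Pure proofs, NO definitions,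
no `sorry`.  COMPUTATIONAL label inherited: the results rest on `tangentPatternPos_two` (`…SahiTangentPatternTwoCheck`, one `native_decide`).

THE MATHEMATICS.  `…SahiTangentPatternTwoGrid` proves the order-3 contraction inequality `p·E₃^{μ}(tops) ≤ E₃^{B_p⊗μ}(F)` for PRODUCT weights
`μ` on grids `[K+1]^d`, `d ≤ 2`.  Generation 47 (`…SahiTangentFKGChain`) passed from product to FKG weights on `Bool × (chain)` by the
row-quantile coupling; here the same one dimension up: an FKG weight `ν` on `Bool × [b+1]^d` is the push-forward of the COIN PRODUCT
`B_q ⊗ g^{⊗d}` (`q = ν(top)`, `g` a probability weight on a fine chain `Fin (K+1)`) along a monotone map FIXING THE COIN,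
`(ε, ω) ↦ (ε, φ(ε, ω))` (`SahiWidth.exists_gridCoupling_fst_prod`, the generation-3 parametrised Rosenblatt coupling with its parameter
coordinate exposed, `…SahiGridCouplingFst`).  Pulled back (`sahiE_pushWeight`), the family `F_U` becomes a pair family on the grid `[K+1]^d`
with up-set tops `φ(⊤,·)⁻¹ U¹_l` and up-set bottoms `φ(⊥,·)⁻¹ U⁰_l ⊆ φ(⊤,·)⁻¹ U¹_l` (monotonicity of `φ` in the coin), the product-weight
theorem applies, and `φ(⊤,·)` pushes `g^{⊗d}` forward to `ν(·|top)`.  Hence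

  **THEOREM (`sahiE_three_fkg_grid_ge_of_le_two`).**  `d ≤ 2`, `ν` an FKG probability weight on `Bool × (Fin d → Fin (b+1))` with
  `0 < ν(top), ν(bottom)`, up-sets `U_l⁰ ⊆ U_l¹` (`l < 3`):  `ν(top) · E₃^{ν(·|top)}(χ_{U¹_0},χ_{U¹_1},χ_{U¹_2}) ≤ E₃^{ν}(F_0,F_1,F_2)`,
  `F_l(ε,x) = χ_{U_l^ε}(x)`.

With `d = 1` this is the order-3 case of `sahiE_fkg_chain_ge_fin`; `d = 2` (FKG weights on the three-dimensional grids `2 × (b+1) × (b+1)`,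
sections along the coin arbitrary FKG-compatible) is NEW.  `sahiE_three_fkg_latticeEmbedding_ge`: the same for every FKG weight on `Bool × L`
whenever the finite distributive lattice `L` admits a lattice embedding into a grid of dimension `≤ 2` (J-width `≤ 2`; e.g. every product
of two chains).  By `…SahiTangentPatternFour` the statement fails for `L = {0,1}⁴` (product measures), so "`≤ 2`" cannot become "all";
J-width `3` is open.  HONEST LABEL: computational (one `native_decide`, part 2 of the `[3]²` certificate). [this work] [computational]
-/

namespace Summit.CriticalPhenomena.PercolationContinuityZ3.Theorems.SahiTangent

open Finset Function Literature.Probability.LatticeModels Literature.Combinatorics.Sahi2008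
open SahiGridPattern (Xd)
open scoped BigOperators

noncomputable section

/-! ### FKG weights on `Bool × [b+1]^d`, `d ≤ 2` -/

section FKGGrid

variable {d b : ℕ}

/-- **CONJECTURE T₃ FOR EVERY FKG WEIGHT ON `Bool × (grid of dimension ≤ 2)`.**  For `d ≤ 2`, an FKG probability weight `ν` on
`Bool × (Fin d → Fin (b+1))` with `q = ν(top row) ∈ (0,1)` and up-sets `U_l⁰ ⊆ U_l¹` of the grid (`l < 3`):
`q · E₃^{ν(·|top)}(χ_{U¹}) ≤ E₃^{ν}(F_U)`, `F_l(ε,x) = χ_{U_l^ε}(x)`.  Proof: the coin-fixing grid coupling pulls `ν` back to a coin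
product over `[K+1]^d`, where `…SahiTangentPatternTwoGrid` applies. [this work] [computational] -/
theorem sahiE_three_fkg_grid_ge_of_le_two (hd : d ≤ 2) {ν : Bool × (Fin d → Fin (b + 1)) → ℝ} (hν : IsFKGMeasure ν)
    (hq₀ : 0 < ∑ x, ν (true, x)) (hq₁ : 0 < ∑ x, ν (false, x))
    (U₀ U₁ : Fin 3 → Finset (Fin d → Fin (b + 1))) (hU₀ : ∀ l, IsUpperSet (U₀ l : Set (Fin d → Fin (b + 1))))
    (hU₁ : ∀ l, IsUpperSet (U₁ l : Set (Fin d → Fin (b + 1)))) (hsub : ∀ l, U₀ l ⊆ U₁ l) :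
    (∑ x, ν (true, x)) * sahiE (fun x => ν (true, x) / ∑ y, ν (true, y)) 3 (fun l => setInd (U₁ l)) ≤
      sahiE ν 3 (fun l (z : Bool × (Fin d → Fin (b + 1))) => if z.1 then setInd (U₁ l) z.2 else setInd (U₀ l) z.2) := by
  classical
  have htot : ∑ z : Bool × (Fin d → Fin (b + 1)), ν z = 1 := hν.sum_eq_one
  rw [Fintype.sum_prod_type, Fintype.sum_bool] at htot
  set qm := ∑ x, ν (true, x) with hqm
  have hqm1 : ∑ x, ν (false, x) = 1 - qm := by linarith
  have hqm0 : 0 ≤ qm := hq₀.le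
  have hqmle : qm ≤ 1 := by linarith [hq₁.le]
  -- the coin-fixing grid coupling
  obtain ⟨K, g, hg0, hg1, φ, hmono, hpush⟩ := SahiWidth.exists_gridCoupling_fst_prod d (T := Bool) hν
  have hφ : ∀ (ε ε' : Bool) (u u' : Fin d → Fin (K + 1)), ε ≤ ε' → u ≤ u' → φ (ε, u) ≤ φ (ε', u') := by
    intro ε ε' u u' hε hu
    exact (hmono (show ((ε, u) : Bool × (Fin d → Fin (K + 1))) ≤ (ε', u') from ⟨hε, hu⟩)).2
  have hW : (fun x : Bool × (Fin d → Fin (K + 1)) => (∑ m, ν (x.1, m)) * ∏ i, g (x.2 i)) =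
      fun z : Bool × (Fin d → Fin (K + 1)) => if z.1 then qm * ∏ a, (fun _ : Fin d => g) a (z.2 a)
        else (1 - qm) * ∏ a, (fun _ : Fin d => g) a (z.2 a) := by
    funext z; rcases z with ⟨c, u⟩; cases c
    · simp [hqm1]
    · simp [← hqm]
  -- pulled-back pairs of up-sets of the grid `[K+1]^d`
  set P₀ : Fin 3 → Finset (Fin d → Fin (K + 1)) := fun l => univ.filter fun u => φ (false, u) ∈ U₀ l with hP₀
  set P₁ : Fin 3 → Finset (Fin d → Fin (K + 1)) := fun l => univ.filter fun u => φ (true, u) ∈ U₁ l with hP₁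
  have hmem₀ : ∀ l u, u ∈ P₀ l ↔ φ (false, u) ∈ U₀ l := fun l u => by rw [hP₀]; simp
  have hmem₁ : ∀ l u, u ∈ P₁ l ↔ φ (true, u) ∈ U₁ l := fun l u => by rw [hP₁]; simp
  have hP₀up : ∀ l, IsUpperSet (P₀ l : Set (Fin d → Fin (K + 1))) := by
    intro l u u' huu' hu
    rw [Finset.mem_coe, hmem₀] at hu ⊢
    exact hU₀ l (hφ false false u u' le_rfl huu') hu
  have hP₁up : ∀ l, IsUpperSet (P₁ l : Set (Fin d → Fin (K + 1))) := by
    intro l u u' huu' hu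
    rw [Finset.mem_coe, hmem₁] at hu ⊢
    exact hU₁ l (hφ true true u u' le_rfl huu') hu
  have hPsub : ∀ l, P₀ l ⊆ P₁ l := by
    intro l u hu
    rw [hmem₀] at hu
    rw [hmem₁]
    exact hsub l (hU₀ l (hφ false true u u (by decide) le_rfl) hu)
  -- the right-hand side through the coupling
  have hE : sahiE ν 3 (fun l (z : Bool × (Fin d → Fin (b + 1))) => if z.1 then setInd (U₁ l) z.2 else setInd (U₀ l) z.2) =
      sahiE (fun z : Bool × (Fin d → Fin (K + 1)) => if z.1 then qm * ∏ a, (fun _ : Fin d => g) a (z.2 a)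
        else (1 - qm) * ∏ a, (fun _ : Fin d => g) a (z.2 a)) 3
        (fun l (z : Bool × (Fin d → Fin (K + 1))) => if z.1 then setInd (P₁ l) z.2 else setInd (P₀ l) z.2) := by
    conv_lhs => rw [← hpush]
    rw [sahiE_pushWeight, hW]
    congr 1
    funext l z
    rcases z with ⟨c, u⟩
    cases c
    · simp [setInd_apply, hmem₀]
    · simp [setInd_apply, hmem₁]
  -- the top functional through the coupling
  have htop : sahiE (fun ω : Fin d → Fin (K + 1) => ∏ a, (fun _ : Fin d => g) a (ω a)) 3 (fun l => setInd (P₁ l)) =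
      sahiE (fun x => ν (true, x) / qm) 3 (fun l => setInd (U₁ l)) := by
    have hp : pushWeight (fun ω : Fin d → Fin (K + 1) => ∏ a, (fun _ : Fin d => g) a (ω a)) (fun ω => φ (true, ω)) =
        fun x => ν (true, x) / qm := by
      funext x
      have h := congrFun hpush (true, x)
      rw [pushWeight_apply, Fintype.sum_prod_type, Fintype.sum_bool] at h
      simp only [Prod.mk.injEq, Bool.false_eq_true, false_and, if_false, Finset.sum_const_zero, add_zero, true_and,
        ← hqm] at h
      rw [pushWeight_apply, eq_div_iff hq₀.ne', Finset.sum_mul]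
      rw [← h]
      refine Finset.sum_congr rfl fun u _ => ?_
      split_ifs <;> ring
    rw [← hp, sahiE_pushWeight]
    congr 1
    funext l u
    simp only [Function.comp_apply, setInd_apply, hmem₁]
  -- the product-weight theorem on the grid `[K+1]^d`
  have main := sahiE_three_coin_grid_ge_of_le_two hd (fun _ : Fin d => g) (fun _ u => hg0 u) (fun _ => hg1) hqm0 hqmle
    (hP₀up 0) (hP₁up 0) (hP₀up 1) (hP₁up 1) (hP₀up 2) (hP₁up 2) (hPsub 0) (hPsub 1) (hPsub 2)
  have e1 : (![setInd (P₁ 0), setInd (P₁ 1), setInd (P₁ 2)] : Fin 3 → (Fin d → Fin (K + 1)) → ℝ) =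
      fun l => setInd (P₁ l) := by
    funext l; fin_cases l <;> rfl
  have e2 : (![fun z : Bool × (Fin d → Fin (K + 1)) => if z.1 then setInd (P₁ 0) z.2 else setInd (P₀ 0) z.2,
        fun z => if z.1 then setInd (P₁ 1) z.2 else setInd (P₀ 1) z.2,
        fun z => if z.1 then setInd (P₁ 2) z.2 else setInd (P₀ 2) z.2] : Fin 3 → Bool × (Fin d → Fin (K + 1)) → ℝ) =
      fun l z => if z.1 then setInd (P₁ l) z.2 else setInd (P₀ l) z.2 := by
    funext l; fin_cases l <;> rfl
  rw [e1, e2, htop] at main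
  rw [hE]
  exact main

end FKGGrid

/-! ### FKG weights on `Bool × L`, `L` of J-width `≤ 2` (lattice embedding into a grid of dimension `≤ 2`) -/

section Embedding

variable {d b : ℕ} {L : Type*} [DistribLattice L] [Fintype L] [DecidableEq L]

/-- **CONJECTURE T₃ FOR EVERY FKG WEIGHT ON `Bool × L`, `L` EMBEDDABLE IN A GRID OF DIMENSION `≤ 2`.**  If the finite distributive lattice
`L` admits an injective `⊓`/`⊔`-preserving map into `Fin d → Fin (b+1)` with `d ≤ 2` (J-width `≤ 2`; every product of two finite chains,
every chain), then for every FKG probability weight `ν` on `Bool × L` with `q = ν(top row) ∈ (0,1)` and up-sets `U_l⁰ ⊆ U_l¹` of `L`: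
`q · E₃^{ν(·|top)}(χ_{U¹}) ≤ E₃^{ν}(F_U)`.  Proof: push `ν` forward to `Bool × (grid)` (still FKG: the image is a sublattice), the sets
to the up-closures of their images, and apply `sahiE_three_fkg_grid_ge_of_le_two`. [this work] [computational] -/
theorem sahiE_three_fkg_latticeEmbedding_ge (hd : d ≤ 2) (e : L → (Fin d → Fin (b + 1))) (he : Function.Injective e)
    (hinf : ∀ x y, e (x ⊓ y) = e x ⊓ e y) (hsup : ∀ x y, e (x ⊔ y) = e x ⊔ e y)
    {ν : Bool × L → ℝ} (hν : IsFKGMeasure ν) (hq₀ : 0 < ∑ x, ν (true, x)) (hq₁ : 0 < ∑ x, ν (false, x))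
    (U₀ U₁ : Fin 3 → Finset L) (hU₀ : ∀ l, IsUpperSet (U₀ l : Set L)) (hU₁ : ∀ l, IsUpperSet (U₁ l : Set L))
    (hsub : ∀ l, U₀ l ⊆ U₁ l) :
    (∑ x, ν (true, x)) * sahiE (fun x => ν (true, x) / ∑ y, ν (true, y)) 3 (fun l => setInd (U₁ l)) ≤
      sahiE ν 3 (fun l (z : Bool × L) => if z.1 then setInd (U₁ l) z.2 else setInd (U₀ l) z.2) := by
  classical
  have hemono : Monotone e := fun x y hxy => by
    rw [← inf_eq_left.2 hxy, hinf]; exact inf_le_right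
  have hele : ∀ x y, e x ≤ e y ↔ x ≤ y := by
    intro x y
    refine ⟨fun h => ?_, fun h => hemono h⟩
    have h1 : e (x ⊓ y) = e x := by rw [hinf]; exact inf_eq_left.2 h
    exact inf_eq_left.1 (he h1)
  -- the pushed weight on `Bool × grid`
  set E : Bool × L → Bool × (Fin d → Fin (b + 1)) := fun z => (z.1, e z.2) with hE
  have hEinj : Function.Injective E := by
    rintro ⟨a, x⟩ ⟨a', x'⟩ h
    simp only [hE, Prod.mk.injEq] at h
    exact Prod.ext h.1 (he h.2)
  set ν' : Bool × (Fin d → Fin (b + 1)) → ℝ := pushWeight ν E with hν'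
  have hν'FKG : IsFKGMeasure ν' := by
    refine isFKGMeasure_pushWeight hν hEinj (fun a c => ?_) (fun a c => ?_)
    · rcases a with ⟨a1, a2⟩; rcases c with ⟨c1, c2⟩
      show ((a1 ⊓ c1, e (a2 ⊓ c2)) : Bool × (Fin d → Fin (b + 1))) = (a1 ⊓ c1, e a2 ⊓ e c2)
      rw [hinf]
    · rcases a with ⟨a1, a2⟩; rcases c with ⟨c1, c2⟩
      show ((a1 ⊔ c1, e (a2 ⊔ c2)) : Bool × (Fin d → Fin (b + 1))) = (a1 ⊔ c1, e a2 ⊔ e c2)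
      rw [hsup]
  -- the up-closures of the images of the sets
  set V₀ : Fin 3 → Finset (Fin d → Fin (b + 1)) := fun l => univ.filter fun m => ∃ x ∈ U₀ l, e x ≤ m with hV₀
  set V₁ : Fin 3 → Finset (Fin d → Fin (b + 1)) := fun l => univ.filter fun m => ∃ x ∈ U₁ l, e x ≤ m with hV₁
  have hmemV₀ : ∀ l m, m ∈ V₀ l ↔ ∃ x ∈ U₀ l, e x ≤ m := fun l m => by rw [hV₀]; simp
  have hmemV₁ : ∀ l m, m ∈ V₁ l ↔ ∃ x ∈ U₁ l, e x ≤ m := fun l m => by rw [hV₁]; simp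
  have hV₀up : ∀ l, IsUpperSet (V₀ l : Set (Fin d → Fin (b + 1))) := by
    intro l m m' hmm' hm
    rw [Finset.mem_coe, hmemV₀] at hm ⊢
    obtain ⟨x, hx, hxm⟩ := hm
    exact ⟨x, hx, hxm.trans hmm'⟩
  have hV₁up : ∀ l, IsUpperSet (V₁ l : Set (Fin d → Fin (b + 1))) := by
    intro l m m' hmm' hm
    rw [Finset.mem_coe, hmemV₁] at hm ⊢
    obtain ⟨x, hx, hxm⟩ := hm
    exact ⟨x, hx, hxm.trans hmm'⟩
  have hVsub : ∀ l, V₀ l ⊆ V₁ l := by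
    intro l m hm
    rw [hmemV₀] at hm
    rw [hmemV₁]
    obtain ⟨x, hx, hxm⟩ := hm
    exact ⟨x, hsub l hx, hxm⟩
  -- on the image the up-closures restrict to the original sets
  have hind₀ : ∀ l x, setInd (V₀ l) (e x) = setInd (U₀ l) x := by
    intro l x
    simp only [setInd_apply, hmemV₀]
    have : (∃ x' ∈ U₀ l, e x' ≤ e x) ↔ x ∈ U₀ l :=
      ⟨fun ⟨x', hx', hle⟩ => hU₀ l ((hele x' x).1 hle) hx', fun hx => ⟨x, hx, le_rfl⟩⟩
    simp only [this]
  have hind₁ : ∀ l x, setInd (V₁ l) (e x) = setInd (U₁ l) x := by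
    intro l x
    simp only [setInd_apply, hmemV₁]
    have : (∃ x' ∈ U₁ l, e x' ≤ e x) ↔ x ∈ U₁ l :=
      ⟨fun ⟨x', hx', hle⟩ => hU₁ l ((hele x' x).1 hle) hx', fun hx => ⟨x, hx, le_rfl⟩⟩
    simp only [this]
  -- row masses of the pushed weight
  have hrow : ∀ a : Bool, (∑ m, ν' (a, m)) = ∑ x, ν (a, x) := by
    intro a
    rw [hν']
    have h : ∀ m, pushWeight ν E (a, m) = ∑ x, if e x = m then ν (a, x) else 0 := by
      intro m
      rw [pushWeight_apply, Fintype.sum_prod_type, Fintype.sum_bool]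
      cases a
      · simp only [hE, Prod.mk.injEq, Bool.true_eq_false, false_and, if_false, Finset.sum_const_zero, zero_add, true_and]
      · simp only [hE, Prod.mk.injEq, Bool.false_eq_true, false_and, if_false, Finset.sum_const_zero, add_zero, true_and]
    simp_rw [h]
    rw [Finset.sum_comm]
    refine Finset.sum_congr rfl fun x _ => ?_
    rw [Finset.sum_ite_eq]
    simp
  have main := sahiE_three_fkg_grid_ge_of_le_two hd hν'FKG (by rw [hrow]; exact hq₀) (by rw [hrow]; exact hq₁) V₀ V₁ hV₀up hV₁up hVsub
  rw [hrow] at main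
  have hR : sahiE ν 3 (fun l (z : Bool × L) => if z.1 then setInd (U₁ l) z.2 else setInd (U₀ l) z.2) =
      sahiE ν' 3 (fun l (z : Bool × (Fin d → Fin (b + 1))) => if z.1 then setInd (V₁ l) z.2 else setInd (V₀ l) z.2) := by
    rw [hν', sahiE_pushWeight]
    congr 1
    funext l z
    rcases z with ⟨c, x⟩
    have hEz : E (c, x) = (c, e x) := rfl
    simp only [Function.comp_apply, hEz]
    cases c
    · simpa using (hind₀ l x).symm
    · simpa using (hind₁ l x).symm
  have hL : sahiE (fun x => ν (true, x) / ∑ y, ν (true, y)) 3 (fun l => setInd (U₁ l)) =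
      sahiE (fun m => ν' (true, m) / ∑ y, ν (true, y)) 3 (fun l => setInd (V₁ l)) := by
    have hp : pushWeight (fun x : L => ν (true, x) / ∑ y, ν (true, y)) e = fun m => ν' (true, m) / ∑ y, ν (true, y) := by
      funext m
      rw [pushWeight_apply, hν', pushWeight_apply, Fintype.sum_prod_type, Fintype.sum_bool]
      simp only [hE, Prod.mk.injEq, Bool.false_eq_true, false_and, if_false, Finset.sum_const_zero, add_zero, true_and]
      rw [Finset.sum_div]
      refine Finset.sum_congr rfl fun x _ => ?_
      split_ifs <;> simp
    rw [← hp, sahiE_pushWeight]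
    congr 1
    funext l x
    simp only [Function.comp_apply]
    exact (hind₁ l x).symm
  rw [hR, hL]
  exact main

end Embedding

/-! ### FKG weights on `Bool × (α × β)`, `α`, `β` finite chains -/

section TwoChains

variable {α β : Type*} [LinearOrder α] [Fintype α] [LinearOrder β] [Fintype β]

/-- **CONJECTURE T₃ FOR EVERY FKG WEIGHT ON `Bool × (α × β)`, `α`, `β` FINITE CHAINS** (the discrete `[0,1]² × coin`): for an FKG
probability weight `ν` on `Bool × (α × β)` with `q = ν(top row) ∈ (0,1)` and up-sets `U_l⁰ ⊆ U_l¹` of `α × β` (`l < 3`),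
`q · E₃^{ν(·|top)}(χ_{U¹}) ≤ E₃^{ν}(F_U)` — via the coordinatewise embedding `α × β ↪ [b+1]²`. [this work] [computational] -/
theorem sahiE_three_fkg_prodChains_ge {ν : Bool × (α × β) → ℝ} (hν : IsFKGMeasure ν) (hq₀ : 0 < ∑ x, ν (true, x))
    (hq₁ : 0 < ∑ x, ν (false, x)) (U₀ U₁ : Fin 3 → Finset (α × β)) (hU₀ : ∀ l, IsUpperSet (U₀ l : Set (α × β)))
    (hU₁ : ∀ l, IsUpperSet (U₁ l : Set (α × β))) (hsub : ∀ l, U₀ l ⊆ U₁ l) :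
    (∑ x, ν (true, x)) * sahiE (fun x => ν (true, x) / ∑ y, ν (true, y)) 3 (fun l => setInd (U₁ l)) ≤
      sahiE ν 3 (fun l (z : Bool × (α × β)) => if z.1 then setInd (U₁ l) z.2 else setInd (U₀ l) z.2) := by
  classical
  -- both chains embed monotonically into `Fin (b+1)`, `b + 1 = |α| + |β|` (both are nonempty)
  have hne : Nonempty (α × β) := by
    by_contra h
    rw [not_nonempty_iff] at h
    exact hq₀.ne' (Fintype.sum_empty _)
  obtain ⟨⟨a₀, b₀⟩⟩ := hne
  have hα : 0 < Fintype.card α := Fintype.card_pos_iff.2 ⟨a₀⟩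
  have hβ : 0 < Fintype.card β := Fintype.card_pos_iff.2 ⟨b₀⟩
  obtain ⟨b, hb⟩ : ∃ b, Fintype.card α + Fintype.card β = b + 1 := Nat.exists_eq_succ_of_ne_zero (by omega)
  have hαb : Fintype.card α ≤ b + 1 := by omega
  have hβb : Fintype.card β ≤ b + 1 := by omega
  let eα : α ≃o Fin (Fintype.card α) := (Fintype.orderIsoFinOfCardEq α rfl).symm
  let eβ : β ≃o Fin (Fintype.card β) := (Fintype.orderIsoFinOfCardEq β rfl).symm
  let fα : α → Fin (b + 1) := fun x => Fin.castLE hαb (eα x)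
  let fβ : β → Fin (b + 1) := fun y => Fin.castLE hβb (eβ y)
  have hfα : StrictMono fα := fun x x' h => by
    show Fin.castLE hαb (eα x) < Fin.castLE hαb (eα x')
    rw [Fin.castLE_lt_castLE_iff]; exact eα.strictMono h
  have hfβ : StrictMono fβ := fun y y' h => by
    show Fin.castLE hβb (eβ y) < Fin.castLE hβb (eβ y')
    rw [Fin.castLE_lt_castLE_iff]; exact eβ.strictMono h
  let e : α × β → (Fin 2 → Fin (b + 1)) := fun p => ![fα p.1, fβ p.2]
  have he : Function.Injective e := by
    intro p p' h
    have h0 := congrFun h 0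
    have h1 := congrFun h 1
    simp only [e, Matrix.cons_val_zero, Matrix.cons_val_one] at h0 h1
    exact Prod.ext (hfα.injective h0) (hfβ.injective h1)
  have hinf : ∀ p p', e (p ⊓ p') = e p ⊓ e p' := by
    intro p p'
    funext i
    rw [Pi.inf_apply]
    fin_cases i
    · show fα (p.1 ⊓ p'.1) = fα p.1 ⊓ fα p'.1
      exact hfα.monotone.map_inf p.1 p'.1
    · show fβ (p.2 ⊓ p'.2) = fβ p.2 ⊓ fβ p'.2
      exact hfβ.monotone.map_inf p.2 p'.2
  have hsup : ∀ p p', e (p ⊔ p') = e p ⊔ e p' := by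
    intro p p'
    funext i
    rw [Pi.sup_apply]
    fin_cases i
    · show fα (p.1 ⊔ p'.1) = fα p.1 ⊔ fα p'.1
      exact hfα.monotone.map_sup p.1 p'.1
    · show fβ (p.2 ⊔ p'.2) = fβ p.2 ⊔ fβ p'.2
      exact hfβ.monotone.map_sup p.2 p'.2
  exact sahiE_three_fkg_latticeEmbedding_ge le_rfl e he hinf hsup hν hq₀ hq₁ U₀ U₁ hU₀ hU₁ hsub

end TwoChains

end

end Summit.CriticalPhenomena.PercolationContinuityZ3.Theorems.SahiTangent
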